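import Summits.BirchSwinnertonDyer.BirchSwinnertonDyer.Theorems.ClassRecordThreeEulerHalvesAtThreeCartanSupplyMonomial
import Summits.BirchSwinnertonDyer.BirchSwinnertonDyer.Theorems.ClassRecordThreeEulerHalvesAtThreeCartanSupplyMonomialCubic
import Summits.BirchSwinnertonDyer.BirchSwinnertonDyer.Theorems.ClassRecordThreeEulerHalvesAtThreeCartanSupplyCubicPointsFixedCount
import HarnessLib

/-!
# VIRTUAL REALISATION over a cyclotomic field, III — the principal series `Ind_B^G(χ₃ ∘ a/d)` has character `χ_W` (`q ≡ 1 (mod 3)`)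

Helper file riding `--supports stmt-BirchSwinnertonDyer-19109` (crux `EulerHalvesAtThree`; UNREGISTERED sub-line `Cruxes/EulerHalvesAtThree/Lines/cartan_corr`,
seat `bsd-idea-10` g13). For a prime `q ≡ 1 (mod 3)` and a field `k` of characteristic `0` containing a primitive cube root of unity `ζ`, the
MONOMIAL REPRESENTATION `monRep (borelSub q) (borelChar hζ h1)` — the principal series induced from the character `(a b; 0 d) ↦ χ₃(a/d)` of the Borel
subgroup, `χ₃` the cubic character of `𝔽_q^×` — has character EQUAL to the tree's class function `cubicNewvectorChar q` (`psChar_eq`). Proof: the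
Frobenius formula of file I, class by class — scalar `q + 1` (`psChar_scalar`), parabolic `1` (`psChar_parabolic`: the `q − 1` conjugates `(a b; 0 a)`,
`b ≠ 0`, all of weight `1`, against the centraliser order `q(q−1)`), split regular `χ₃(l/m) + χ₃(m/l) = 2` or `−1` (`psChar_split`: the `2q` conjugates
`(l b; 0 m)`, `(m b; 0 l)` against `(q−1)²`), elliptic `0` (no upper-triangular conjugate). So for `q ≡ 1 (mod 3)` the virtual realisation of `χ_W` is an
honest one, `B = 0`.
HONEST FRAMING: finite-group character computation; nothing about NUM, crux 23422 ∕ 19109 or any summit statement is proved by this seat; BSD is proved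
for no curve. [folklore; cite: Bump1997 §4.1; SerreLinearRepresentations1977 §7.2]
-/

set_option linter.dupNamespace false
set_option autoImplicit false

noncomputable section

namespace Summit.BirchSwinnertonDyer.BirchSwinnertonDyer.Theorems.CartanSupply.Monomial

open Summit.BirchSwinnertonDyer.BirchSwinnertonDyer.Theorems.CartanDegree
open Summit.BirchSwinnertonDyer.BirchSwinnertonDyer.Theorems.CartanTorusCubeCut
open scoped Classical

variable {q : ℕ} [Fact q.Prime] {k : Type*} [Field k] {ζ : kˣ} (hζ : IsPrimitiveRoot ζ 3)

/-! ## §1 The Borel character `(a b; 0 d) ↦ χ₃(a/d)` -/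

omit [Fact q.Prime] in
/-- PROVED: `3 ∣ |𝔽_q^×|` for `q ≡ 1 (mod 3)`. [folklore] -/
theorem three_dvd_card_units [Fact q.Prime] (h1 : q % 3 = 1) : 3 ∣ Fintype.card (ZMod q)ˣ := by
  rw [ZMod.card_units q]; omega

/-- The cubic character `χ₃` of `𝔽_q^×` (`q ≡ 1 (mod 3)`). -/
def unitCubicChar (h1 : q % 3 = 1) : (ZMod q)ˣ →* kˣ := cubicChar inferInstance hζ (three_dvd_card_units h1)

/-- The BOREL CHARACTER `ψ̃ : B → k`, `(a b; 0 d) ↦ χ₃(a/d)`. -/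
def borelChar (h1 : q % 3 = 1) : borelSub q →* k := (Units.coeHom k).comp ((unitCubicChar hζ h1).comp diagRatio)

/-- PROVED: unfolding. [folklore] -/
theorem borelChar_apply (h1 : q % 3 = 1) (g : borelSub q) : borelChar hζ h1 g = ((unitCubicChar hζ h1 (diagRatio g) : kˣ) : k) := rfl

/-- PROVED: **the weight of `(a b; 0 d)` is `χ₃(a/d)`.** [folklore] -/
theorem wt_upperGL (h1 : q % 3 = 1) (a d : (ZMod q)ˣ) (b : ZMod q) :
    wt (borelSub q) (borelChar hζ h1) (upperGL a d b) = ((unitCubicChar hζ h1 (a * d⁻¹) : kˣ) : k) := by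
  rw [wt_of_mem _ _ (upperGL_mem a d b), borelChar_apply, diagRatio_upperGL]

/-- PROVED: `χ₃(r) = 1 ↔ r^{(q−1)/3} = 1`. [folklore] -/
theorem unitCubicChar_eq_one_iff (h1 : q % 3 = 1) (r : (ZMod q)ˣ) : unitCubicChar hζ h1 r = 1 ↔ (r : ZMod q) ^ ((q - 1) / 3) = 1 := by
  unfold unitCubicChar
  rw [cubicChar_eq_one_iff_pow, ZMod.card_units q, ← Units.val_pow_eq_pow_val, Units.val_eq_one]

/-- PROVED: the trace identity for `χ₃`. [folklore] -/
theorem unitCubicChar_add_inv (h1 : q % 3 = 1) (r : (ZMod q)ˣ) :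
    ((unitCubicChar hζ h1 r : kˣ) : k) + ((unitCubicChar hζ h1 r⁻¹ : kˣ) : k) = if unitCubicChar hζ h1 r = 1 then 2 else -1 :=
  val_add_val_inv _ hζ _ r

/-! ## §2 Cardinalities cast into `k` -/

omit [Fact q.Prime] in
/-- PROVED: `|B| = q (q−1)²` in `k`. [folklore] -/
theorem card_borelSub_cast [Fact q.Prime] : (Nat.card (borelSub q) : k) = (q : k) * ((q : k) - 1) ^ 2 := by
  rw [card_borelSub, Nat.cast_mul, Nat.cast_pow, Nat.cast_sub (Fact.out : q.Prime).one_lt.le, Nat.cast_one]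

omit [Fact q.Prime] in
/-- PROVED: `|G| = q (q−1)² (q+1)` in `k`. [folklore] -/
theorem card_G_cast [Fact q.Prime] : (Fintype.card (G q) : k) = (q : k) * ((q : k) - 1) ^ 2 * ((q : k) + 1) := by
  rw [← Int.cast_natCast (R := k), NormOne.card_G_int]; push_cast; ring

/-- PROVED: `|B| ≠ 0` in characteristic `0`. [folklore] -/
theorem card_borelSub_ne_zero [CharZero k] : (Nat.card (borelSub q) : k) ≠ 0 := by
  rw [card_borelSub]
  have hq := (Fact.out : q.Prime)
  exact Nat.cast_ne_zero.2 (mul_ne_zero hq.ne_zero (pow_ne_zero 2 (Nat.sub_ne_zero_of_lt hq.one_lt)))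

/-- PROVED: the Frobenius formula of file I, instantiated on `GL₂(𝔽_q)` (with this file's decidability instances). [folklore] -/
theorem frobenius_GL (H : Subgroup (G q)) (θ : H →* k) (g : G q) :
    (Nat.card H : k) * (monRep H θ).character g =
      ((Finset.univ.filter fun x : G q => x⁻¹ * g * x = g).card : k) *
        ∑ y ∈ Finset.univ.filter (fun y : G q => ∃ x : G q, x⁻¹ * g * x = y), wt H θ y := by
  convert card_mul_character_eq_classSum H θ g

/-! ## §3 The class sum over `B`, parametrised -/

/-- PROVED: a class sum of the weight over any finset `univ.filter P` is the parametrised sum over `(a, d, b)`. [folklore] -/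
theorem classSum_borel (h1 : q % 3 = 1) (P : G q → Prop) [DecidablePred P] :
    ∑ y ∈ Finset.univ.filter P, wt (borelSub q) (borelChar hζ h1) y =
      ∑ p : (ZMod q)ˣ × (ZMod q)ˣ × ZMod q,
        if P (upperGL p.1 p.2.1 p.2.2) then ((unitCubicChar hζ h1 (p.1 * p.2.1⁻¹) : kˣ) : k) else 0 := by
  rw [Finset.sum_filter,
    ← Finset.sum_subset (Finset.subset_univ (Finset.univ.filter fun g : G q => (g : Mat q) 1 0 = 0)) (fun y _ hy => ?_)]
  · rw [borel_eq_image, Finset.sum_image (fun p _ p' _ h => upperGL_injective h)]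
    refine Finset.sum_congr rfl (fun p _ => ?_)
    rw [wt_upperGL]
  · have hy' : y ∉ borelSub q := fun h => hy (Finset.mem_filter.2 ⟨Finset.mem_univ _, h⟩)
    rw [wt_of_not_mem _ _ hy', ite_self]

/-! ## §4 The character, class by class -/

/-- PROVED — **SCALAR**: `χ(z) = q + 1`. [folklore] -/
theorem psChar_scalar [CharZero k] (h1 : q % 3 = 1) {g : G q} (hs : IsScalarMat (g : Mat q)) :
    (monRep (borelSub q) (borelChar hζ h1)).character g = (q : k) + 1 := by
  have key := frobenius_GL (borelSub q) (borelChar hζ h1) g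
  have hC : (Finset.univ.filter fun x : G q => x⁻¹ * g * x = g) = Finset.univ :=
    Finset.filter_true_of_mem (fun x _ => NormOne.conj_of_isScalar g x hs)
  have hcl : (Finset.univ.filter fun y : G q => ∃ x : G q, x⁻¹ * g * x = y) = {g} := by
    ext y
    simp only [Finset.mem_filter, Finset.mem_univ, true_and, Finset.mem_singleton]
    constructor
    · rintro ⟨x, hx⟩; rw [NormOne.conj_of_isScalar g x hs] at hx; exact hx.symm
    · rintro rfl; exact ⟨1, by simp⟩
  have hgB : g ∈ borelSub q := hs.2.1
  have hwt : wt (borelSub q) (borelChar hζ h1) g = 1 := by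
    rw [wt_of_mem _ _ hgB, borelChar_apply]
    have hdr : diagRatio ⟨g, hgB⟩ = 1 := by
      apply Units.ext
      rw [diagRatio_val, Units.val_one]
      show (g : Mat q) 0 0 * ((g : Mat q) 1 1)⁻¹ = 1
      rw [hs.2.2, mul_inv_cancel₀ (CubicPoints.diag_ne_zero_of_upper g hgB).2]
    rw [hdr, map_one, Units.val_one]
  rw [hC, hcl, Finset.sum_singleton, Finset.card_univ, hwt, mul_one, card_G_cast] at key
  apply mul_left_cancel₀ (card_borelSub_ne_zero (q := q) (k := k))
  rw [key, card_borelSub_cast]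

/-- PROVED — **ELLIPTIC**: `χ(g) = 0` (no conjugate of `g` is upper-triangular). [folklore] -/
theorem psChar_elliptic [CharZero k] (h1 : q % 3 = 1) {g : G q} (hg : ¬ HasRatEigenvalue (g : Mat q)) :
    (monRep (borelSub q) (borelChar hζ h1)).character g = 0 := by
  have key := frobenius_GL (borelSub q) (borelChar hζ h1) g
  have hsum : ∑ y ∈ Finset.univ.filter (fun y : G q => ∃ x : G q, x⁻¹ * g * x = y), wt (borelSub q) (borelChar hζ h1) y = 0 := by
    refine Finset.sum_eq_zero (fun y hy => ?_)
    obtain ⟨x, rfl⟩ := (Finset.mem_filter.1 hy).2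
    refine wt_of_not_mem _ _ (fun hB => hg ?_)
    obtain ⟨a, d, b, he⟩ := exists_upperGL_of_mem hB
    have := hasRatEigenvalue_upperGL a d b
    rw [he] at this
    exact (NormOne.hasRatEigenvalue_conj g x).1 this
  rw [hsum, mul_zero] at key
  exact (mul_eq_zero.1 key).resolve_left card_borelSub_ne_zero

/-- PROVED — **PARABOLIC**: `χ(g) = 1` for non-scalar `g` with `Δ = 0`. [folklore] -/
theorem psChar_parabolic [CharZero k] (h1 : q % 3 = 1) {g : G q} (hns : ¬ IsScalarMat (g : Mat q))
    (hΔ : (g : Mat q).trace ^ 2 - 4 * (g : Mat q).det = 0) :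
    (monRep (borelSub q) (borelChar hζ h1)).character g = 1 := by
  have hq2 : q ≠ 2 := by rintro rfl; simp at h1
  have hq1 : 1 ≤ q := (Fact.out : q.Prime).one_lt.le
  have h2 : (2 : ZMod q) ≠ 0 := (ManinLocalTwoThree.SL2ZModOddPrime.neZero_two hq2).out
  -- `a₀ = tr g / 2`, `det g = a₀²`
  have hdet : (g : Mat q).det = ((g : Mat q).trace * 2⁻¹) * ((g : Mat q).trace * 2⁻¹) := by
    have h4 : (4 : ZMod q) ≠ 0 := by
      have : (4 : ZMod q) = 2 * 2 := by norm_num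
      rw [this]; exact mul_ne_zero h2 h2
    apply mul_left_cancel₀ h4
    have e : 4 * (g : Mat q).det = (g : Mat q).trace ^ 2 := by linear_combination -hΔ
    rw [e]; field_simp; ring
  have ha0 : (g : Mat q).trace * 2⁻¹ ≠ 0 := fun h => (Matrix.GeneralLinearGroup.det_ne_zero g) (by rw [hdet, h, mul_zero])
  have hsum2 : (g : Mat q).trace * 2⁻¹ + (g : Mat q).trace * 2⁻¹ = (g : Mat q).trace := by
    rw [← mul_two, mul_assoc, inv_mul_cancel₀ h2, mul_one]
  have key := frobenius_GL (borelSub q) (borelChar hζ h1) g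
  rw [card_centralizer_parabolic hq2 g hns hΔ, classSum_borel, ← Finset.sum_filter] at key
  -- the conjugates in `B`: `(a₀ b; 0 a₀)`, `b ≠ 0`
  have hset : (Finset.univ.filter fun p : (ZMod q)ˣ × (ZMod q)ˣ × ZMod q => ∃ x : G q, x⁻¹ * g * x = upperGL p.1 p.2.1 p.2.2) =
      (Finset.univ.filter fun b : ZMod q => b ≠ 0).image (fun b => (Units.mk0 _ ha0, Units.mk0 _ ha0, b)) := by
    ext ⟨a, d, b⟩
    simp only [Finset.mem_filter, Finset.mem_univ, true_and, Finset.mem_image, Prod.mk.injEq]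
    rw [conj_upperGL_iff g hns]
    constructor
    · rintro ⟨hnsc, hs, hp⟩
      have had : (a : ZMod q) = d := roots_parabolic hs hp hΔ
      have ha : (a : ZMod q) = (g : Mat q).trace * 2⁻¹ := by
        rw [← hs, ← had, ← mul_two, mul_assoc, mul_inv_cancel₀ h2, mul_one]
      refine ⟨b, fun hb => hnsc ⟨hb, Units.ext had⟩, Units.ext ha.symm, Units.ext (by rw [Units.val_mk0, ← had, ha]), rfl⟩
    · rintro ⟨b', hb', ha, hd, rfl⟩
      have ha' : (a : ZMod q) = (g : Mat q).trace * 2⁻¹ := by rw [← ha, Units.val_mk0]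
      have hd' : (d : ZMod q) = (g : Mat q).trace * 2⁻¹ := by rw [← hd, Units.val_mk0]
      refine ⟨fun h => hb' h.1, by rw [ha', hd', hsum2], by rw [ha', hd', ← hdet]⟩
  rw [hset, Finset.sum_image (fun b _ b' _ h => by simpa using h)] at key
  simp only [mul_inv_cancel, map_one, Units.val_one, Finset.sum_const, nsmul_eq_mul, mul_one] at key
  rw [Finset.filter_ne' Finset.univ (0 : ZMod q), Finset.card_erase_of_mem (Finset.mem_univ _), Finset.card_univ, ZMod.card,
    Nat.cast_sub hq1, Nat.cast_one, Nat.cast_mul, Nat.cast_sub hq1, Nat.cast_one] at key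
  apply mul_left_cancel₀ (card_borelSub_ne_zero (q := q) (k := k))
  rw [card_borelSub_cast] at key ⊢
  rw [key]; ring

/-- PROVED — **SPLIT REGULAR**: `χ(g) = 2` if the eigenvalue ratio is a cube (`IsScalarMat (g^{(q−1)/3})`), else `−1`. [folklore] -/
theorem psChar_split [CharZero k] (h1 : q % 3 = 1) {g : G q} (hr : HasRatEigenvalue (g : Mat q))
    (hΔ : (g : Mat q).trace ^ 2 - 4 * (g : Mat q).det ≠ 0) :
    (monRep (borelSub q) (borelChar hζ h1)).character g = if IsScalarMat ((g : Mat q) ^ ((q - 1) / 3)) then 2 else -1 := by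
  have hns : ¬ IsScalarMat (g : Mat q) := fun hs => hΔ (PS.discr_eq_zero_of_isScalar hs)
  obtain ⟨l, hl⟩ := hr
  obtain ⟨m, hm⟩ : ∃ m : ZMod q, m = (g : Mat q).trace - l := ⟨_, rfl⟩
  have hsum : l + m = (g : Mat q).trace := by rw [hm]; ring
  have hprod : l * m = (g : Mat q).det := by rw [hm]; linear_combination -hl
  have hlm : l ≠ m := by
    intro h; apply hΔ; rw [← hsum, ← hprod, ← h]; ring
  have hdet0 : (g : Mat q).det ≠ 0 := Matrix.GeneralLinearGroup.det_ne_zero g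
  have hl0 : l ≠ 0 := fun h => hdet0 (by rw [← hprod, h, zero_mul])
  have hm0 : m ≠ 0 := fun h => hdet0 (by rw [← hprod, h, mul_zero])
  have hLM : Units.mk0 l hl0 ≠ Units.mk0 m hm0 := fun h => hlm (by rw [← Units.val_mk0 hl0, h, Units.val_mk0])
  have key := frobenius_GL (borelSub q) (borelChar hζ h1) g
  rw [NormOne.card_centralizer_of_split g ⟨l, hl⟩ hΔ, classSum_borel, ← Finset.sum_filter] at key
  -- the conjugates in `B`: `(l b; 0 m)` and `(m b; 0 l)`
  have hset : (Finset.univ.filter fun p : (ZMod q)ˣ × (ZMod q)ˣ × ZMod q => ∃ x : G q, x⁻¹ * g * x = upperGL p.1 p.2.1 p.2.2) =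
      Finset.univ.image (fun b : ZMod q => (Units.mk0 l hl0, Units.mk0 m hm0, b)) ∪
        Finset.univ.image (fun b : ZMod q => (Units.mk0 m hm0, Units.mk0 l hl0, b)) := by
    ext ⟨a, d, b⟩
    simp only [Finset.mem_filter, Finset.mem_univ, true_and, Finset.mem_image, Finset.mem_union, Prod.mk.injEq]
    rw [conj_upperGL_iff g hns]
    constructor
    · rintro ⟨-, hs, hp⟩
      rw [← hsum] at hs; rw [← hprod] at hp
      rcases roots_split hs hp with ⟨ha, hd⟩ | ⟨ha, hd⟩
      · exact Or.inl ⟨b, Units.ext ha.symm, Units.ext hd.symm, rfl⟩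
      · exact Or.inr ⟨b, Units.ext ha.symm, Units.ext hd.symm, rfl⟩
    · rintro (⟨b', ha, hd, rfl⟩ | ⟨b', ha, hd, rfl⟩)
      · have ha' : (a : ZMod q) = l := by rw [← ha, Units.val_mk0]
        have hd' : (d : ZMod q) = m := by rw [← hd, Units.val_mk0]
        exact ⟨fun h => hlm (by rw [← ha', ← hd', h.2]), by rw [ha', hd', hsum], by rw [ha', hd', hprod]⟩
      · have ha' : (a : ZMod q) = m := by rw [← ha, Units.val_mk0]
        have hd' : (d : ZMod q) = l := by rw [← hd, Units.val_mk0]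
        exact ⟨fun h => hlm (by rw [← ha', ← hd', h.2]), by rw [ha', hd', add_comm, hsum], by rw [ha', hd', mul_comm, hprod]⟩
  have hdisj : Disjoint (Finset.univ.image (fun b : ZMod q => (Units.mk0 l hl0, Units.mk0 m hm0, b)))
      (Finset.univ.image (fun b : ZMod q => (Units.mk0 m hm0, Units.mk0 l hl0, b))) := by
    rw [Finset.disjoint_left]
    rintro p hp hp'
    obtain ⟨b, _, rfl⟩ := Finset.mem_image.1 hp
    obtain ⟨b', _, he⟩ := Finset.mem_image.1 hp'
    simp only [Prod.mk.injEq] at he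
    exact hLM he.1.symm
  rw [hset, Finset.sum_union hdisj, Finset.sum_image (fun b _ b' _ h => by simpa using h),
    Finset.sum_image (fun b _ b' _ h => by simpa using h)] at key
  simp only [Finset.sum_const, Finset.card_univ, ZMod.card, nsmul_eq_mul] at key
  -- `χ₃(l/m) + χ₃(m/l) = 2` or `−1`
  have hinv : Units.mk0 m hm0 * (Units.mk0 l hl0)⁻¹ = (Units.mk0 l hl0 * (Units.mk0 m hm0)⁻¹)⁻¹ := by rw [mul_inv_rev, inv_inv]
  rw [hinv, ← mul_add, unitCubicChar_add_inv] at key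
  -- the cube test: `χ₃(l/m) = 1 ↔ l^k = m^k ↔ IsScalarMat (g^k)`
  have htest : (unitCubicChar hζ h1 (Units.mk0 l hl0 * (Units.mk0 m hm0)⁻¹) = 1) ↔ IsScalarMat ((g : Mat q) ^ ((q - 1) / 3)) := by
    rw [unitCubicChar_eq_one_iff, CubicPointsFixed.isScalarMat_pow_iff_of_split (g : Mat q) hns hlm hsum hprod, Units.val_mul,
      Units.val_inv_eq_inv_val, Units.val_mk0, Units.val_mk0, mul_pow, inv_pow, mul_inv_eq_one₀ (pow_ne_zero _ hm0)]
  apply mul_left_cancel₀ (card_borelSub_ne_zero (q := q) (k := k))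
  rw [key, card_borelSub_cast, Nat.cast_pow, Nat.cast_sub (Fact.out : q.Prime).one_lt.le, Nat.cast_one]
  by_cases hc : IsScalarMat ((g : Mat q) ^ ((q - 1) / 3))
  · rw [if_pos hc, if_pos (htest.2 hc)]; ring
  · rw [if_neg hc, if_neg (fun h => hc (htest.1 h))]; ring

/-! ## §5 The values of `χ_W` by type (`q ≡ 1 (mod 3)`) and the identity -/

/-- PROVED: `χ_W(parabolic) = 1`. [folklore] -/
theorem char_parabolic_ps (h1 : q % 3 = 1) {g : G q} (hns : ¬ IsScalarMat (g : Mat q)) (hΔ : (g : Mat q).trace ^ 2 - 4 * (g : Mat q).det = 0) :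
    cubicNewvectorChar q g = 1 := by
  unfold cubicNewvectorChar cubicNewvectorCharMat
  simp only [h1, hΔ, hns, if_true, if_false]

/-- PROVED: `χ_W(split regular) = 2` or `−1` by the cube test. [folklore] -/
theorem char_split_ps (h1 : q % 3 = 1) {g : G q} (hr : HasRatEigenvalue (g : Mat q)) (hΔ : (g : Mat q).trace ^ 2 - 4 * (g : Mat q).det ≠ 0) :
    cubicNewvectorChar q g = if IsScalarMat ((g : Mat q) ^ ((q - 1) / 3)) then 2 else -1 := by
  unfold cubicNewvectorChar cubicNewvectorCharMat
  simp only [h1, hΔ, hr, if_true, if_false]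

/-- PROVED — **THE PRINCIPAL SERIES HAS CHARACTER `χ_W`** (`q ≡ 1 (mod 3)`, `k ⊇ μ₃` of characteristic `0`). [folklore; cite: Bump1997 §4.1] -/
theorem psChar_eq [CharZero k] (h1 : q % 3 = 1) (g : G q) :
    (monRep (borelSub q) (borelChar hζ h1)).character g = (cubicNewvectorChar q g : k) := by
  by_cases hs : IsScalarMat (g : Mat q)
  · rw [psChar_scalar hζ h1 hs, PS.char_of_isScalar_ps h1 hs]; push_cast; ring
  by_cases hΔ : (g : Mat q).trace ^ 2 - 4 * (g : Mat q).det = 0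
  · rw [psChar_parabolic hζ h1 hs hΔ, char_parabolic_ps h1 hs hΔ]; push_cast; ring
  by_cases hr : HasRatEigenvalue (g : Mat q)
  · rw [psChar_split hζ h1 hr hΔ, char_split_ps h1 hr hΔ]
    split_ifs <;> push_cast <;> ring
  · rw [psChar_elliptic hζ h1 hr, cubicNewvectorChar, PS.charMat_elliptic h1 hr]; push_cast; ring

end Summit.BirchSwinnertonDyer.BirchSwinnertonDyer.Theorems.CartanSupply.Monomial

end
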